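import Literature.AnabelianGeometry.SemiGraphs.ProSigmaCompletionWreath
import Mathlib.GroupTheory.SemidirectProduct
import Mathlib.GroupTheory.FreeGroup.NielsenSchreier
import Mathlib.GroupTheory.Coset.Basic
import HarnessLib

/-!
# Free-factor malnormality in pro-`Σ` completions, I: the wreath obstruction and the lifting lemma

Ribes–Zalesskii, *Profinite Groups* (2nd ed.), Thm. 9.1.12: a free factor `A` of a free pro-`𝒞` product
`G = A ∐ B` satisfies `A ∩ gAg⁻¹ = 1` for `g ∉ A` [cite: RibesZalesskii2010, Thm. 9.1.12].  For the
pro-`Σ` completion `ι : Γ → P` of a free group `Γ` with basis `b : β → Γ` and the closed subgroup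
`A = closure ι⟨b(S)⟩` generated by PART of the basis (`S ⊆ β`) this is the group-theoretic input "(M)" of
the verticial clauses of [CombGC] Prop. 1.2 at genuine multi-vertex pointed stable curves (the verticial
subgroup of an irreducible component is the closure of a free factor of the discrete fundamental group).
The tree holds the rank-one case `S = {i}` (`ProSigmaCompletionMalnormal.lean`, abc-iut-L5-t9 /
abc-iut-L3-t11: the wreath product `C_{p^k} ≀ Q`).  This file supplies the two elementary engines of a
Kurosh-free proof of the general case (`ProSigmaFreeFactorMalnormal.lean`):

* `wreath_prod_left_eq_one_of_commute` — in `M ≀ Q` (`M` commutative): if `z` commutes with `w`, where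
  `z.right ∉ H̄`, `w.right ∈ H̄` and `w.left` is supported on the subgroup `H̄ ≤ Q`, then
  `∏_{q ∈ H̄} w.left q = 1` (multiply the coordinates of `zw = wz` over `H̄`: the `z.left`-terms agree,
  the `z.right`-translate of `w.left` has no support on `H̄`);
* `exists_wreathSupportHom` — the elements with `right ∈ H̄` and `left` supported on `H̄` form a subgroup
  on which `w ↦ ∏_{q ∈ H̄} w.left q` is a homomorphism;
* `exists_lift_of_retract` — the LIFTING LEMMA: for the retraction `ρ` of `Γ` onto `Γ_S = ⟨b(S)⟩`
  (`b j ↦ b j` for `j ∈ S`, `b j ↦ 1` otherwise), a subgroup `D ≤ Γ_S` and `Γ₁ = ρ⁻¹(D)`, every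
  homomorphism `α : D → W` together with prescribed values on the conjugates `γ b_j γ⁻¹` (`j ∉ S`)
  compatible over a quotient `θ : W → Q` extends to `ψ : Γ₁ → W` over `Q` with `ψ|_D = α`.  (Route:
  `Φ : Γ → F(Γ × T) ⋊ Γ`, `b_s ↦ (1, b_s)`, `b_t ↦ ((1,t), 1)`, `T = β ∖ S`; back `Ψ`, `(w,t) ↦ w b_t w⁻¹`;
  `Ψ ∘ Φ = id`; twist `α` along a right transversal of `D` in `Γ` — a fragment of Reidemeister–Schreier
  for the subgroup `ρ⁻¹(D)`, by universal properties only, no reduced words.)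

Theorems only; classical (pro)finite group theory; nothing here refers to the IUT corpus or takes a
side on [IUTchIII] Cor. 3.12.
-/

namespace Literature.AnabelianGeometry.SemiGraphs.SemiGraphOfAnabelioids.IsProSigmaCompletion

open Literature.AnabelianGeometry.Anabelioids

/-! ### The wreath obstruction for a supported element -/

section Wreath

variable {Q : Type*} [Group Q] {M : Type*} [CommGroup M]

/-- **The wreath obstruction, supported form.**  In `M ≀ Q` (`M` commutative) let `H̄ ≤ Q`, and let
`z`, `w` commute, with `z.right ∉ H̄`, `w.right ∈ H̄` and `w.left q = 1` for `q ∉ H̄`.  Then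
`∏_{q ∈ H̄} w.left q = 1`.  (Coordinates of `z w = w z` at `q`:
`z.left q · w.left (z.right⁻¹ q) = w.left q · z.left (w.right⁻¹ q)`; multiply over `q ∈ H̄`: the
`z.left`-products agree because `w.right ∈ H̄`, and `w.left (z.right⁻¹ q) = 1` because
`z.right⁻¹ q ∉ H̄`.) [cite: RibesZalesskii2010, Thm. 9.1.12] -/
theorem wreath_prod_left_eq_one_of_commute [Fintype Q] (Hbar : Subgroup Q)
    [DecidablePred (· ∈ Hbar)] (z w : M ≀ᵣ Q) (hz : z.right ∉ Hbar) (hw : w.right ∈ Hbar)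
    (hsupp : ∀ q, q ∉ Hbar → w.left q = 1) (h : Commute z w) :
    ∏ q ∈ Finset.univ.filter (· ∈ Hbar), w.left q = 1 := by
  classical
  set S : Finset Q := Finset.univ.filter (· ∈ Hbar) with hS
  have hmemS : ∀ q, q ∈ S ↔ q ∈ Hbar := fun q => by simp [hS]
  -- the commutation identity, coordinate by coordinate
  have hq : ∀ q, z.left q * w.left (z.right⁻¹ * q) = w.left q * z.left (w.right⁻¹ * q) := by
    intro q
    have := congrArg (fun v : M ≀ᵣ Q => v.left q) h.eq
    simpa only [RegularWreathProduct.mul_left, Pi.mul_apply] using this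
  have hprod := Finset.prod_congr rfl fun q (_ : q ∈ S) => hq q
  rw [Finset.prod_mul_distrib, Finset.prod_mul_distrib] at hprod
  -- (i) the `z.left`-terms agree
  have h1 : ∏ q ∈ S, z.left (w.right⁻¹ * q) = ∏ q ∈ S, z.left q := by
    refine Finset.prod_bijective (fun q => w.right⁻¹ * q) (Group.mulLeft_bijective _) (fun q => ?_)
      (fun q _ => rfl)
    rw [hmemS, hmemS]
    have hc : w.right⁻¹ ∈ Hbar := Hbar.inv_mem hw
    constructor
    · exact fun hq' => Hbar.mul_mem hc hq'
    · intro hq'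
      have := Hbar.mul_mem (Hbar.inv_mem hc) hq'
      rwa [inv_mul_cancel_left] at this
  -- (ii) the `z.right`-translate of `w.left` has no support on `S`
  have h2 : ∏ q ∈ S, w.left (z.right⁻¹ * q) = 1 := by
    refine Finset.prod_eq_one fun q hqS => hsupp _ fun hmem => hz ?_
    have hq' : q ∈ Hbar := (hmemS q).mp hqS
    have : z.right = q * (z.right⁻¹ * q)⁻¹ := by group
    rw [this]
    exact Hbar.mul_mem hq' (Hbar.inv_mem hmem)
  rw [h1, h2, mul_one] at hprod
  -- `Z = W * Z`
  have hprod' : (1 : M) * ∏ q ∈ S, z.left q = (∏ q ∈ S, w.left q) * ∏ q ∈ S, z.left q := by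
    rw [one_mul]; exact hprod
  exact (mul_right_cancel hprod').symm

/-- **The supported subgroup and its coordinate-product homomorphism.**  In `M ≀ Q` (`M` commutative)
the elements `w` with `w.right ∈ H̄` and `w.left q = 1` for `q ∉ H̄` form a subgroup, on which
`w ↦ ∏_{q ∈ H̄} w.left q` is a homomorphism (for `w₁.right ∈ H̄` the translate by `w₁.right⁻¹`
permutes `H̄`). [cite: RibesZalesskii2010, Thm. 9.1.12] -/
theorem exists_wreathSupportHom [Fintype Q] (Hbar : Subgroup Q) [DecidablePred (· ∈ Hbar)] :
    ∃ (WH : Subgroup (M ≀ᵣ Q)) (μ : WH →* M),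
      (∀ w : M ≀ᵣ Q, w ∈ WH ↔ (w.right ∈ Hbar ∧ ∀ q, q ∉ Hbar → w.left q = 1)) ∧
      ∀ w : WH, μ w = ∏ q ∈ Finset.univ.filter (· ∈ Hbar), (w : M ≀ᵣ Q).left q := by
  classical
  set S : Finset Q := Finset.univ.filter (· ∈ Hbar) with hS
  have hmemS : ∀ q, q ∈ S ↔ q ∈ Hbar := fun q => by simp [hS]
  -- translating by an element of `H̄` permutes `S`
  have hperm : ∀ (f : Q → M) {h : Q}, h ∈ Hbar → ∏ q ∈ S, f (h⁻¹ * q) = ∏ q ∈ S, f q := by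
    intro f h hh
    refine Finset.prod_bijective (fun q => h⁻¹ * q) (Group.mulLeft_bijective _) (fun q => ?_)
      (fun q _ => rfl)
    rw [hmemS, hmemS]
    constructor
    · exact fun hq' => Hbar.mul_mem (Hbar.inv_mem hh) hq'
    · intro hq'
      have := Hbar.mul_mem hh hq'
      rwa [mul_inv_cancel_left] at this
  let WH : Subgroup (M ≀ᵣ Q) :=
    { carrier := {w | w.right ∈ Hbar ∧ ∀ q, q ∉ Hbar → w.left q = 1}
      mul_mem' := by
        rintro w₁ w₂ ⟨h₁, hs₁⟩ ⟨h₂, hs₂⟩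
        refine ⟨by simpa using Hbar.mul_mem h₁ h₂, fun q hq => ?_⟩
        simp only [RegularWreathProduct.mul_left, Pi.mul_apply]
        rw [hs₁ q hq, hs₂ _ (fun hmem => hq ?_), one_mul]
        have := Hbar.mul_mem h₁ hmem
        rwa [mul_inv_cancel_left] at this
      one_mem' := ⟨by simp, fun q _ => by simp⟩
      inv_mem' := by
        rintro w ⟨h₁, hs₁⟩
        refine ⟨by simpa using Hbar.inv_mem h₁, fun q hq => ?_⟩
        simp only [RegularWreathProduct.inv_left, Pi.inv_apply, inv_eq_one]
        exact hs₁ _ fun hmem => hq (by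
          have := Hbar.mul_mem (Hbar.inv_mem h₁) hmem
          rwa [inv_mul_cancel_left] at this) }
  have hWH : ∀ w : M ≀ᵣ Q, w ∈ WH ↔ (w.right ∈ Hbar ∧ ∀ q, q ∉ Hbar → w.left q = 1) :=
    fun w => Iff.rfl
  let μ : WH →* M :=
    { toFun := fun w => ∏ q ∈ S, (w : M ≀ᵣ Q).left q
      map_one' := by simp
      map_mul' := by
        rintro ⟨w₁, h₁, -⟩ ⟨w₂, -, -⟩
        simp only [Subgroup.coe_mul, RegularWreathProduct.mul_left, Pi.mul_apply,
          Finset.prod_mul_distrib]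
        rw [hperm (fun q => w₂.left q) h₁] }
  exact ⟨WH, μ, hWH, fun w => rfl⟩

/-- The lift `(δ_c, q)` of a generator: `δ_c` (value `c` at `1`, `1` elsewhere) is supported on any
subgroup `H̄`, and the product of its values over `H̄` is `c`. [cite: RibesZalesskii2010, Thm. 9.1.12] -/
theorem wreath_prod_indicator [Fintype Q] [DecidableEq Q] (Hbar : Subgroup Q)
    [DecidablePred (· ∈ Hbar)] (c : M) :
    (∀ q, q ∉ Hbar → (fun q' : Q => if q' = 1 then c else 1) q = 1) ∧
      ∏ q ∈ Finset.univ.filter (· ∈ Hbar), (fun q' : Q => if q' = 1 then c else 1) q = c := by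
  refine ⟨fun q hq => if_neg (fun h => hq (by rw [h]; exact Hbar.one_mem)), ?_⟩
  rw [Finset.prod_ite_eq']
  simp [Hbar.one_mem]

omit [Group Q] [CommGroup M] in
/-- The order of `M ≀ Q` is a `Σ`-integer when `|M|` and `|Q|` are.
[cite: RibesZalesskii2010, Thm. 9.1.12] -/
theorem isSigmaInteger_card_regularWreath {Sigma : Set ℕ} [Finite M] [Finite Q]
    (hM : IsSigmaInteger Sigma (Nat.card M)) (hQ : IsSigmaInteger Sigma (Nat.card Q)) :
    IsSigmaInteger Sigma (Nat.card (M ≀ᵣ Q)) := by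
  rw [RegularWreathProduct.card]
  refine IsSigmaInteger.mul ?_ hQ
  induction Nat.card Q with
  | zero => rw [pow_zero]; exact IsSigmaInteger.one Sigma
  | succ k ih => rw [pow_succ]; exact ih.mul hM

end Wreath

/-! ### The lifting lemma for `Γ₁ = ρ⁻¹(D)` -/

section Lifting

variable {β Γ : Type*} [Group Γ]

/-- The retraction `ρ` (`b j ↦ b j` for `j ∈ S`, `b j ↦ 1` otherwise) takes values in
`Γ_S = ⟨b(S)⟩`, fixes `Γ_S` pointwise, and is idempotent. [cite: RibesZalesskii2010, Thm. 9.1.12] -/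
theorem retract_mem_closure (b : FreeGroupBasis β Γ) (S : Set β) [DecidablePred (· ∈ S)]
    (ρ : Γ →* Γ) (hρ : ∀ j, ρ (b j) = if j ∈ S then b j else 1) :
    (∀ γ, ρ γ ∈ Subgroup.closure (b '' S)) ∧
      (∀ γ, γ ∈ Subgroup.closure (b '' S) → ρ γ = γ) ∧ ∀ γ, ρ (ρ γ) = ρ γ := by
  -- values in `Γ_S`: factor `ρ` through `Γ_S`
  let ρ₀ : Γ →* Subgroup.closure (b '' S) :=
    b.lift fun j => if h : j ∈ S then ⟨b j, Subgroup.subset_closure ⟨j, h, rfl⟩⟩ else 1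
  have hρ₀ : (Subgroup.closure (b '' S)).subtype.comp ρ₀ = ρ := by
    refine b.ext_hom _ _ fun j => ?_
    rw [MonoidHom.comp_apply, hρ j]
    change ((b.lift _ (b j) : Subgroup.closure (b '' S)) : Γ) = _
    rw [FreeGroupBasis.lift_apply_basis]
    by_cases h : j ∈ S
    · rw [dif_pos h, if_pos h]
    · rw [dif_neg h, if_neg h]; rfl
  have h1 : ∀ γ, ρ γ ∈ Subgroup.closure (b '' S) := fun γ => by
    rw [← hρ₀]
    exact (ρ₀ γ).2
  -- identity on `Γ_S`
  have h2 : ∀ γ, γ ∈ Subgroup.closure (b '' S) → ρ γ = γ := by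
    intro γ hγ
    have heq : Set.EqOn ρ (MonoidHom.id Γ) (b '' S) := by
      rintro _ ⟨j, hj, rfl⟩
      rw [hρ j, if_pos hj]; rfl
    exact MonoidHom.eqOn_closure heq hγ
  exact ⟨h1, h2, fun γ => h2 _ (h1 γ)⟩

/-- **The lifting lemma for `Γ₁ = ρ⁻¹(D)`.**  Let `Γ` be free with basis `b : β → Γ`, `S ⊆ β`, `ρ` the
retraction onto `Γ_S = ⟨b(S)⟩` killing the other basis elements, `D ≤ Γ_S` a subgroup and
`Γ₁ = ρ⁻¹(D)`.  Let `θ : W → Q` and `π : Γ₁ → Q` be homomorphisms, `α : D → W` a homomorphism over `π`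
(`θ ∘ α = π` on `D`), and `X γ j ∈ W` (`γ ∈ Γ`, `j ∉ S`) elements over `π (γ b_j γ⁻¹)`.  Then there is a
homomorphism `ψ : Γ₁ → W` over `π` (`θ ∘ ψ = π`) extending `α`.  Construction: `T = β ∖ S`,
`Φ : Γ → F(Γ × T) ⋊ Γ` (`Γ` acting on `F(Γ × T)` through left translation of the index) with
`b_s ↦ (1, b_s)`, `b_t ↦ ((1, t), 1)`, so that `Φ` has second component `ρ` and `Φ|_{Γ_S} = inr`; the
homomorphism `Ψ` back (`(w, t) ↦ w b_t w⁻¹`, identity on `Γ`) satisfies `Ψ ∘ Φ = id`; with a right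
transversal `w = d_w r_w` of `D` in `Γ`, `α_K (w, t) := α(d_w) X(r_w, t) α(d_w)⁻¹` is `D`-equivariant, and
`ψ γ := α_K((Φ γ).left) · α(ρ γ)`. [cite: RibesZalesskii2010, Thm. 9.1.12] -/
theorem exists_lift_of_retract {W Q : Type*} [Group W] [Group Q]
    (b : FreeGroupBasis β Γ) (S : Set β) [DecidablePred (· ∈ S)]
    (ρ : Γ →* Γ) (hρ : ∀ j, ρ (b j) = if j ∈ S then b j else 1)
    (D Γ₁ : Subgroup Γ) (hD : D ≤ Subgroup.closure (b '' S)) (hΓ₁ : ∀ γ, γ ∈ Γ₁ ↔ ρ γ ∈ D)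
    (θ : W →* Q) (π : Γ₁ →* Q) (α : D →* W)
    (hα : ∀ (d : Γ) (hd : d ∈ D) (hd₁ : d ∈ Γ₁), θ (α ⟨d, hd⟩) = π ⟨d, hd₁⟩)
    (X : Γ → β → W)
    (hX : ∀ (γ : Γ) (j : β), j ∉ S → ∀ h₁ : γ * b j * γ⁻¹ ∈ Γ₁,
      θ (X γ j) = π ⟨γ * b j * γ⁻¹, h₁⟩) :
    ∃ ψ : Γ₁ →* W,
      (∀ (d : Γ) (hd : d ∈ D) (hd₁ : d ∈ Γ₁), ψ ⟨d, hd₁⟩ = α ⟨d, hd⟩) ∧ ∀ γ, θ (ψ γ) = π γ := by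
  classical
  obtain ⟨hρS, hρid, hρρ⟩ := retract_mem_closure b S ρ hρ
  -- membership bookkeeping
  have hDΓ₁ : ∀ d, d ∈ D → d ∈ Γ₁ := fun d hd => (hΓ₁ d).mpr (by rwa [hρid d (hD hd)])
  have hρD : ∀ γ : Γ₁, ρ γ ∈ D := fun γ => (hΓ₁ γ).mp γ.2
  have hconj : ∀ (γ : Γ) (j : β), j ∉ S → γ * b j * γ⁻¹ ∈ Γ₁ := by
    intro γ j hj
    rw [hΓ₁, map_mul, map_mul, map_inv, hρ j, if_neg hj, mul_one, mul_inv_cancel]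
    exact D.one_mem
  -- the index type `T = β ∖ S` and the action of `Γ` on `F(Γ × T)` by left translation of the index
  let T := {j : β // j ∉ S}
  let e : Γ → (Γ × T ≃ Γ × T) := fun g => Equiv.prodCongr (Equiv.mulLeft g) (Equiv.refl T)
  have he_one : e 1 = Equiv.refl _ := by
    ext p <;> simp [e]
  have he_mul : ∀ g g', e (g * g') = (e g').trans (e g) := by
    intro g g'
    ext p <;> simp [e, mul_assoc]
  let φ : Γ →* MulAut (FreeGroup (Γ × T)) :=
    { toFun := fun g => FreeGroup.freeGroupCongr (e g)
      map_one' := by rw [he_one, FreeGroup.freeGroupCongr_refl]; rfl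
      map_mul' := fun g g' => by
        rw [he_mul, ← FreeGroup.freeGroupCongr_trans]; rfl }
  have hφof : ∀ (g w : Γ) (t : T), φ g (FreeGroup.of (w, t)) = FreeGroup.of (g * w, t) := by
    intro g w t
    change FreeGroup.freeGroupCongr (e g) (FreeGroup.of (w, t)) = _
    rw [FreeGroup.freeGroupCongr_apply, FreeGroup.map.of]
    rfl
  -- `Φ : Γ → F(Γ × T) ⋊ Γ`
  let Φ : Γ →* FreeGroup (Γ × T) ⋊[φ] Γ :=
    b.lift fun j => if h : j ∈ S then SemidirectProduct.inr (b j)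
      else SemidirectProduct.inl (FreeGroup.of ((1 : Γ), ⟨j, h⟩))
  have hΦS : ∀ j, j ∈ S → Φ (b j) = SemidirectProduct.inr (b j) := fun j hj => by
    change b.lift _ (b j) = _
    rw [FreeGroupBasis.lift_apply_basis, dif_pos hj]
  have hΦT : ∀ j (hj : j ∉ S), Φ (b j) = SemidirectProduct.inl (FreeGroup.of ((1 : Γ), ⟨j, hj⟩)) :=
    fun j hj => by
    change b.lift _ (b j) = _
    rw [FreeGroupBasis.lift_apply_basis, dif_neg hj]
  -- second component of `Φ` is `ρ`
  have hΦright : ∀ γ, (Φ γ).right = ρ γ := by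
    have : SemidirectProduct.rightHom.comp Φ = ρ := by
      refine b.ext_hom _ _ fun j => ?_
      rw [MonoidHom.comp_apply, hρ j]
      by_cases hj : j ∈ S
      · rw [hΦS j hj, if_pos hj, SemidirectProduct.rightHom_inr]
      · rw [hΦT j hj, if_neg hj, SemidirectProduct.rightHom_inl]
    intro γ
    exact congrArg (fun F : Γ →* Γ => F γ) this
  -- `Φ|_{Γ_S} = inr`
  have hΦinr : ∀ γ, γ ∈ Subgroup.closure (b '' S) → Φ γ = SemidirectProduct.inr γ := by
    have heq : Set.EqOn Φ (SemidirectProduct.inr : Γ →* FreeGroup (Γ × T) ⋊[φ] Γ) (b '' S) := by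
      rintro _ ⟨j, hj, rfl⟩
      exact hΦS j hj
    intro γ hγ
    exact MonoidHom.eqOn_closure heq hγ
  -- `Ψ_K : F(Γ × T) → Γ₁`, `(w, t) ↦ w b_t w⁻¹`, and `Ψ ∘ Φ = id`
  let ΨK₁ : FreeGroup (Γ × T) →* Γ₁ :=
    FreeGroup.lift fun p => ⟨p.1 * b p.2.1 * p.1⁻¹, hconj p.1 p.2.1 p.2.2⟩
  let ΨK : FreeGroup (Γ × T) →* Γ := Γ₁.subtype.comp ΨK₁
  have hΨKof : ∀ (w : Γ) (t : T), ΨK (FreeGroup.of (w, t)) = w * b t.1 * w⁻¹ := fun w t => by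
    simp only [ΨK, ΨK₁, MonoidHom.comp_apply, FreeGroup.lift_apply_of, Subgroup.coe_subtype]
  have hΨcompat : ∀ g : Γ, ΨK.comp (φ g).toMonoidHom =
      (MulAut.conj ((MonoidHom.id Γ) g)).toMonoidHom.comp ΨK := by
    intro g
    refine FreeGroup.ext_hom _ _ fun p => ?_
    obtain ⟨w, t⟩ := p
    simp only [MonoidHom.comp_apply, MulEquiv.coe_toMonoidHom, MulAut.conj_apply,
      MonoidHom.id_apply]
    rw [hφof, hΨKof, hΨKof]
    group
  let Ψ : FreeGroup (Γ × T) ⋊[φ] Γ →* Γ := SemidirectProduct.lift ΨK (MonoidHom.id Γ) hΨcompat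
  have hΨapply : ∀ v : FreeGroup (Γ × T) ⋊[φ] Γ, Ψ v = ΨK v.left * v.right := fun v => rfl
  have hΨΦ : ∀ γ, Ψ (Φ γ) = γ := by
    have : Ψ.comp Φ = MonoidHom.id Γ := by
      refine b.ext_hom _ _ fun j => ?_
      rw [MonoidHom.comp_apply, MonoidHom.id_apply]
      by_cases hj : j ∈ S
      · rw [hΦS j hj]
        exact SemidirectProduct.lift_inr _ _ _ _
      · rw [hΦT j hj, SemidirectProduct.lift_inl, hΨKof]
        simp
    intro γ
    exact congrArg (fun F : Γ →* Γ => F γ) this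
  -- a right transversal of `D` in `Γ`: `w = d_w · r_w`
  let r : Γ → Γ := fun w => (Quotient.mk (QuotientGroup.rightRel D) w).out
  have hr : ∀ w, w * (r w)⁻¹ ∈ D := fun w => by
    have : QuotientGroup.rightRel D (r w) w :=
      Quotient.exact (Quotient.out_eq (Quotient.mk (QuotientGroup.rightRel D) w))
    exact QuotientGroup.rightRel_apply.mp this
  have hrD : ∀ (d w : Γ), d ∈ D → r (d * w) = r w := by
    intro d w hd
    change (Quotient.mk (QuotientGroup.rightRel D) (d * w)).out = (Quotient.mk _ w).out
    congr 1
    refine Quotient.sound (QuotientGroup.rightRel_apply.mpr ?_)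
    rw [mul_inv_rev, ← mul_assoc, mul_inv_cancel, one_mul]
    exact D.inv_mem hd
  let dD : Γ → D := fun w => ⟨w * (r w)⁻¹, hr w⟩
  have hdD : ∀ (d w : Γ) (hd : d ∈ D), dD (d * w) = ⟨d, hd⟩ * dD w := by
    intro d w hd
    ext
    change d * w * (r (d * w))⁻¹ = d * (w * (r w)⁻¹)
    rw [hrD d w hd, mul_assoc]
  have hdDr : ∀ w, (dD w : Γ) * r w = w := fun w => by
    change w * (r w)⁻¹ * r w = w
    rw [inv_mul_cancel_right]
  -- the twisted homomorphism on `F(Γ × T)`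
  let αK : FreeGroup (Γ × T) →* W :=
    FreeGroup.lift fun p => α (dD p.1) * X (r p.1) p.2.1 * (α (dD p.1))⁻¹
  have hαKof : ∀ (w : Γ) (t : T),
      αK (FreeGroup.of (w, t)) = α (dD w) * X (r w) t.1 * (α (dD w))⁻¹ := fun w t => by
    change FreeGroup.lift _ (FreeGroup.of (w, t)) = _
    rw [FreeGroup.lift_apply_of]
  -- `D`-equivariance of `α_K`
  have hαK_equiv : ∀ (d : Γ) (hd : d ∈ D) (κ : FreeGroup (Γ × T)),
      αK (φ d κ) = α ⟨d, hd⟩ * αK κ * (α ⟨d, hd⟩)⁻¹ := by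
    intro d hd κ
    have : αK.comp (φ d).toMonoidHom = (MulAut.conj (α ⟨d, hd⟩)).toMonoidHom.comp αK := by
      refine FreeGroup.ext_hom _ _ fun p => ?_
      obtain ⟨w, t⟩ := p
      simp only [MonoidHom.comp_apply, MulEquiv.coe_toMonoidHom, MulAut.conj_apply]
      rw [hφof, hαKof, hαKof, hdD d w hd, hrD d w hd, map_mul, mul_inv_rev]
      group
    exact congrArg (fun F : FreeGroup (Γ × T) →* W => F κ) this
  -- `θ ∘ α_K = π ∘ Ψ_K`
  have hθαK : ∀ κ, θ (αK κ) = π (ΨK₁ κ) := by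
    have : θ.comp αK = π.comp ΨK₁ := by
      refine FreeGroup.ext_hom _ _ fun p => ?_
      obtain ⟨w, t⟩ := p
      simp only [MonoidHom.comp_apply]
      rw [hαKof, map_mul, map_mul, map_inv, hα _ (dD w).2 (hDΓ₁ _ (dD w).2),
        hX (r w) t.1 t.2 (hconj _ _ t.2), ← map_inv, ← map_mul, ← map_mul]
      congr 1
      ext
      change (dD w : Γ) * (r w * b t.1 * (r w)⁻¹) * (dD w : Γ)⁻¹ =
        ((FreeGroup.lift _ (FreeGroup.of (w, t)) : Γ₁) : Γ)
      rw [FreeGroup.lift_apply_of]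
      change _ = w * b t.1 * w⁻¹
      conv_rhs => rw [← hdDr w]
      group
    intro κ
    exact congrArg (fun F : FreeGroup (Γ × T) →* Q => F κ) this
  -- the lift `ψ γ := α_K((Φ γ).left) · α(ρ γ)`
  let ψ : Γ₁ →* W :=
    { toFun := fun γ => αK (Φ (γ : Γ)).left * α ⟨ρ γ, hρD γ⟩
      map_one' := by
        have h1 : (⟨ρ ((1 : Γ₁) : Γ), hρD 1⟩ : D) = 1 := Subtype.ext (by simp)
        rw [h1, map_one, mul_one, Subgroup.coe_one, map_one, SemidirectProduct.one_left, map_one]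
      map_mul' := fun γ γ' => by
        have e1 : (⟨ρ ((γ * γ' : Γ₁) : Γ), hρD (γ * γ')⟩ : D) = ⟨ρ γ, hρD γ⟩ * ⟨ρ γ', hρD γ'⟩ := by
          ext; simp
        rw [e1, map_mul α, Subgroup.coe_mul, map_mul Φ, SemidirectProduct.mul_left, map_mul αK,
          hΦright, hαK_equiv (ρ γ) (hρD γ)]
        group }
  refine ⟨ψ, fun d hd hd₁ => ?_, fun γ => ?_⟩
  · -- `ψ|_D = α`
    change αK (Φ d).left * α ⟨ρ d, _⟩ = α ⟨d, hd⟩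
    rw [hΦinr d (hD hd), SemidirectProduct.left_inr, map_one, one_mul]
    congr 1
    ext
    exact hρid d (hD hd)
  · -- over `π`
    change θ (αK (Φ (γ : Γ)).left * α ⟨ρ γ, _⟩) = π γ
    rw [map_mul, hθαK, hα _ (hρD γ) (hDΓ₁ _ (hρD γ)), ← map_mul]
    congr 1
    ext
    change ((ΨK₁ (Φ (γ : Γ)).left : Γ₁) : Γ) * ρ γ = γ
    rw [← hΦright γ]
    exact (hΨapply (Φ γ)).symm.trans (hΨΦ γ)

end Lifting

end Literature.AnabelianGeometry.SemiGraphs.SemiGraphOfAnabelioids.IsProSigmaCompletion
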